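import Summits.HodgeConjecture.HodgeCM.Model.ArchLineDatumOf_2

/-! PORT of `HodgeCM/Model/ArchLineDatumOf.lean` (HodgeCMPerL run 82) — part 3: continuation of `Summits.HodgeConjecture.HodgeCM.Model.ArchLineDatumOf_2` (split at a top-level declaration boundary by port_pkg.py; scope re-opened below; declarations unchanged). -/

-- port_pkg: scope re-opened for this part (file-level context, then the namespace/section stack open at the cut)
set_option autoImplicit false
noncomputable section
open NumberField NumberField.InfinitePlace NumberField.mixedEmbedding IsDedekindDomain
open scoped Matrix Kronecker Classical TensorProduct ComplexConjugate SchwartzMap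
open MvPolynomial
open Literature.NumberTheory.Automorphic Literature.NumberTheory.Automorphic.UnitaryGroup Literature.NumberTheory.Weil1964
open Literature.RepresentationTheory.HeisenbergGroup (polar symplecticGroup)
open Literature.RepresentationTheory.KonnoKonno2007 Literature.RepresentationTheory.KonnoKonno2007.RealDualPair
open Literature.NumberTheory.GelbartRogawski1991 Literature.NumberTheory.GelbartRogawski1991.UnitaryDualPair
open Literature.RepresentationTheory (atPlace)
open Literature.Analysis.SegalBargmann
open HodgeCM.Adelic HodgeCM.PerL34 HodgeCM.Model.HypCensus HodgeCM.Model.SupplyInstance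
namespace HodgeCM.Model.ArchSideTerm
section Datum
variable {L : CMField} {ι₁ : L →+* ℂ} (V : HermSpace3 L ι₁) (S : StubTree.SeesawDatum L)
variable
  (hGR : (cmSplittingDatum (L : Type) finProdFinEquiv (frameD V) (frameD_real V) (frameD_ne V) (dW S) (dW_real S) (dW_ne S)).CompatibleSplitting)
  (hGR₀ : (cmSplittingDatum (L : Type) (e₁) (frameD V) (frameD_real V) (frameD_ne V) (lineVec (L : Type) (dW S 0))
    (fun _ => dW_real S 0) (fun _ => dW_ne S 0)).CompatibleSplitting)
  (hGR₁ : (cmSplittingDatum (L : Type) (e₁) (frameD V) (frameD_real V) (frameD_ne V) (lineVec (L : Type) (dW S 1))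
    (fun _ => dW_real S 1) (fun _ => dW_ne S 1)).CompatibleSplitting)
  (hGR₂ : (cmSplittingDatum (L : Type) (e₁) (frameD V) (frameD_real V) (frameD_ne V) (lineVec (L : Type) (dW' S 0))
    (fun _ => dW'_real S 0) (fun _ => dW'_ne S 0)).CompatibleSplitting)
  (hGR₃ : (cmSplittingDatum (L : Type) (e₁) (frameD V) (frameD_real V) (frameD_ne V) (lineVec (L : Type) (dW' S 1))
    (fun _ => dW'_real S 1) (fun _ => dW'_ne S 1)).CompatibleSplitting)
  (η : CMAdelic (L : Type) (frameD V) × CMAdelic (L : Type) (dW S) →* ℂˣ)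
  (μ : Fin 4 → (InfinitePlace (L : Type) → ℤ))
  (hpos₀ : 0 < cmXW (L : Type) (frameD V) (lineVec (L : Type) (dW S 0)) (fun _ => dW_real S 0) ι₁ (HypCensus.cmPlace (L : Type) ι₁) 0)
  (hpos₁ : 0 < cmXW (L : Type) (frameD V) (lineVec (L : Type) (dW S 1)) (fun _ => dW_real S 1) ι₁ (HypCensus.cmPlace (L : Type) ι₁) 0)
  (hpos₂ : 0 < cmXW (L : Type) (frameD V) (lineVec (L : Type) (dW' S 0)) (fun _ => dW'_real S 0) ι₁ (HypCensus.cmPlace (L : Type) ι₁) 0)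
  (hpos₃ : 0 < cmXW (L : Type) (frameD V) (lineVec (L : Type) (dW' S 1)) (fun _ => dW'_real S 1) ι₁ (HypCensus.cmPlace (L : Type) ι₁) 0)
variable {V S hGR hGR₀ hGR₁ hGR₂ hGR₃ η μ hpos₀ hpos₁ hpos₂ hpos₃}
section ReadOff
variable
  {hμ₀ : ∀ t : ↥(Literature.NumberTheory.Automorphic.relNormOneInfUnits (↥(maximalRealSubfield L)) L),
      ((eta₀ V S η (1, (cmAdelicOneEquivRelNormOne (L : Type)).symm (Literature.NumberTheory.Automorphic.relNormOneInfToIdeles (↥(maximalRealSubfield L)) L t)) *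
              cmLineChar₀ (L : Type) finProdFinEquiv e₁ (frameD V) (frameD_real V) (frameD_ne V) (dW S) (dW_real S) (dW_ne S)
                hGR hGR₀ hGR₁
                (1, CMCenter (L : Type) (lineVec (L : Type) (dW S 0))
                  ((cmAdelicOneEquivRelNormOne (L : Type)).symm (Literature.NumberTheory.Automorphic.relNormOneInfToIdeles (↥(maximalRealSubfield L)) L t))) :
            ℂˣ) : ℂ) * lineC V (dW S 0) (dW_real S 0) (dW_ne S 0) hGR₀ t =
        Literature.NumberTheory.Automorphic.archWeight (L : Type) (μ 0) t}
  {hμ₁ : ∀ t : ↥(Literature.NumberTheory.Automorphic.relNormOneInfUnits (↥(maximalRealSubfield L)) L),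
      ((eta₁ V S η (1, (cmAdelicOneEquivRelNormOne (L : Type)).symm (Literature.NumberTheory.Automorphic.relNormOneInfToIdeles (↥(maximalRealSubfield L)) L t)) *
              cmLineChar₁ (L : Type) finProdFinEquiv e₁ (frameD V) (frameD_real V) (frameD_ne V) (dW S) (dW_real S) (dW_ne S)
                hGR hGR₀ hGR₁
                (1, CMCenter (L : Type) (lineVec (L : Type) (dW S 1))
                  ((cmAdelicOneEquivRelNormOne (L : Type)).symm (Literature.NumberTheory.Automorphic.relNormOneInfToIdeles (↥(maximalRealSubfield L)) L t))) :
            ℂˣ) : ℂ) * lineC V (dW S 1) (dW_real S 1) (dW_ne S 1) hGR₁ t =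
        Literature.NumberTheory.Automorphic.archWeight (L : Type) (μ 1) t}
  {hμ₂ : ∀ t : ↥(Literature.NumberTheory.Automorphic.relNormOneInfUnits (↥(maximalRealSubfield L)) L),
      ((eta₂ V S η (1, (cmAdelicOneEquivRelNormOne (L : Type)).symm (Literature.NumberTheory.Automorphic.relNormOneInfToIdeles (↥(maximalRealSubfield L)) L t)) *
              cmConjLineChar₀ (L : Type) finProdFinEquiv e₁ (frameD V) (frameD_real V) (frameD_ne V) (dW S) (dW_real S) (dW_ne S)
                (dW' S) (dW'_real S) (dW'_ne S) S.isoGL (isoGL_hg₀ S) hGR hGR₂ hGR₃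
                (1, CMCenter (L : Type) (lineVec (L : Type) (dW' S 0))
                  ((cmAdelicOneEquivRelNormOne (L : Type)).symm (Literature.NumberTheory.Automorphic.relNormOneInfToIdeles (↥(maximalRealSubfield L)) L t))) :
            ℂˣ) : ℂ) * lineC V (dW' S 0) (dW'_real S 0) (dW'_ne S 0) hGR₂ t =
        Literature.NumberTheory.Automorphic.archWeight (L : Type) (μ 2) t}
  {hμ₃ : ∀ t : ↥(Literature.NumberTheory.Automorphic.relNormOneInfUnits (↥(maximalRealSubfield L)) L),
      ((eta₃ V S η (1, (cmAdelicOneEquivRelNormOne (L : Type)).symm (Literature.NumberTheory.Automorphic.relNormOneInfToIdeles (↥(maximalRealSubfield L)) L t)) *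
              cmConjLineChar₁ (L : Type) finProdFinEquiv e₁ (frameD V) (frameD_real V) (frameD_ne V) (dW S) (dW_real S) (dW_ne S)
                (dW' S) (dW'_real S) (dW'_ne S) S.isoGL (isoGL_hg₀ S) hGR hGR₂ hGR₃
                (1, CMCenter (L : Type) (lineVec (L : Type) (dW' S 1))
                  ((cmAdelicOneEquivRelNormOne (L : Type)).symm (Literature.NumberTheory.Automorphic.relNormOneInfToIdeles (↥(maximalRealSubfield L)) L t))) :
            ℂˣ) : ℂ) * lineC V (dW' S 1) (dW'_real S 1) (dW'_ne S 1) hGR₃ t =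
        Literature.NumberTheory.Automorphic.archWeight (L : Type) (μ 3) t}
/-- (Ported verbatim from the HodgeCMPerL package; no docstring in the source.) -/
theorem archLineDatumOf_x₀ :
    (archLineDatumOf V S hGR hGR₀ hGR₁ hGR₂ hGR₃ η μ hpos₀ hpos₁ hpos₂ hpos₃ hμ₀ hμ₁ hμ₂ hμ₃).x₀ = lineX₀Vec V S hpos₀ hpos₁ hpos₂ hpos₃ := rfl

/-- (Ported verbatim from the HodgeCMPerL package; no docstring in the source.) -/
theorem archLineDatumOf_c :
    (archLineDatumOf V S hGR hGR₀ hGR₁ hGR₂ hGR₃ η μ hpos₀ hpos₁ hpos₂ hpos₃ hμ₀ hμ₁ hμ₂ hμ₃).c = lineCVec V S hGR₀ hGR₁ hGR₂ hGR₃ := rfl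

end ReadOff

end Datum

end HodgeCM.Model.ArchSideTerm

end
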